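import Summits.QuantumFields.YangMills.Theorems.UnitScaleTiltProp7FlatSourcedMeanValue
import Summits.QuantumFields.YangMills.Theorems.UnitScaleTiltProp7GreenKernelSiteRows
import Summits.QuantumFields.YangMills.Theorems.UnitScaleTiltProp7NearFieldGreenSizeSum
import Literature.MathematicalPhysics.QuantumFieldTheory.Balaban1983to89.B3TorusRadialSums
import Literature.MathematicalPhysics.QuantumFieldTheory.Balaban1983to89.B3Taylor310LocalRemainder
import HarnessLib

/-!
# Route `UnitScaleTilt`, crux K1 «MinimiserStabilityRegPr» (stmt-QuantumFields-19200), route-R E′ path (α′), (E1-b), row (hK₂-W) — FILE 2a: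
# HARMONIC-FUNCTION LETTERS ON THE TORUS `T^{(j)}` — the periodic pullback `transl x₀ : ℤ^d → T^{(j)}` on a box (distance, injectivity,
# box sum ≤ ball sum, the lift), the INTERIOR MEAN-VALUE BOUND for a site function harmonic on a `tdist`-ball (BULK core), the SOURCED
# mean-value bound for a constant Laplacian (PIN core), and `Σ_{tdist(z,y) ≤ ρ} G̃(EK y − EK z)² ≤ C·(ρ + 1)` in `d = 3`

Cell `ym3-torus`, width seat `ym3-torus-px7` (gen 3), LOCATE 19200 evidence `LOCATE-HK2W-HARMONIC-px7g3.md` §2 (BULK)(PIN); FILE 1 = ✓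
`…Prop7InterpErrorLocalLaplaceEnergy` (p669609).  `--supports stmt-QuantumFields-19200`, count-neutral.  THEOREMS ONLY (0 `def`, 0 `sorry`).
YM₃ on T³ is a ladder rung (R3), not the Clay problem; nothing here claims the stub, the crux, d = 4 or the gap.

THE POINT.  (hK₂-W) is proved by HARMONICITY: `Δ(φ − φ_H) = Δφ − V`, `V := Δφ_H` harmonic off the pins.  The pointwise control of a
lattice-harmonic function by its local `ℓ²` mass is the tree's `ℤ^d` De Giorgi road (✓ `Prop7FlatInteriorMeanValue.sq_le_of_harmonic`, ✓
`Prop7FlatSourcedMeanValue.sq_le_of_lop_eq_dvg`); this file is the once-and-for-all TORUS READING of those two bricks for SITE functions on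
`tdist`-balls (the bricks' own torus readings are for bond fields), plus the one Green-function sum the pin term needs.

WHAT IS PROVED (ns `…Theorems.Prop7InterpErrorHarmonicLetters`; torus `T^{(j)}` = `Site P j`, period `N = sitesPerDir j`).
* §1 pullback letters (`2r < N`, `w ∈ box 0 r`): `valMinAbs_transl_sub` (`((x₀+w) − x₀)_μ~ = w_μ`), `tdist_transl_eq` (`tdist(x₀+w, x₀) = Σ|w_μ|`),
  `tdist_transl_le` (`≤ d·r`), `transl_injOn_box`, ★ `sum_box_pullback_le_sum_ball` (`g ≥ 0 ⇒ Σ_{w∈box 0 r} g(x₀+w) ≤ Σ_{tdist(z,x₀) ≤ ρ} g z` for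
  `d·r ≤ ρ`), `exists_eq_transl_of_tdist_le` (the `valMinAbs` lift: `tdist(x,x₀) ≤ ρ₀ ⇒ x = x₀ + w`, `w ∈ box 0 ρ₀`).
* §2 ★★ `sq_le_mul_sum_ball_of_laplace_eq_zero` (BULK core): `laplace c V = 0` on `{tdist(·,x) ≤ ρ}`, `d·(n + d(n+2)) ≤ ρ`, `2(n + d(n+2)) < N`, `c ≠ 0`
  ⇒ `V(x)² ≤ 2^d(1+56d)^d(n+1)^{−d}·Σ_{tdist(z,x) ≤ ρ} V(z)²`.
* §3 ★★ `sq_le_of_laplace_one_eq_const` (PIN core): `laplace 1 W = σ` (a constant) on `{tdist(·,y) ≤ d(r+1)}`, `r = ρ₀ + n + d(n+2)`, `2(r+1) < N`,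
  `tdist(x,y) ≤ ρ₀` ⇒ `W(x)² ≤ 4K·Σ_{tdist(z,y) ≤ ρ} W(z)² + (4K(2r+1)^d + 2)·(64·2^d·d·m·(2r+1))²`, `K = 2^d(1+56d)^d(n+1)^{−d}`, `m = |σ|(r+1)∕d`
  (the constant is the divergence of the linear field `w ↦ −(σ∕d)·w_μ`).
* §4 ★ `sum_ball_sq_torusGreen_EK_le` (`P.d = 3`): `∃ C ≥ 0, Σ_{tdist(z,y) ≤ ρ} G̃(EK y − EK z)² ≤ C·(ρ + 1)` (✓ `abs_torusGreen_le` at the pole, ✓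
  `abs_torusGreen_EK_sub_mul_dist_le` + ✓ `tdist_sq_le_card_mul_sum_sq` on the `supDist`-shells, ✓ `B3TorusRadialSums.card_shell_le`).
HONEST SCOPE.  Readings and bookkeeping; the two `ℤ^d` estimates and the three Green-function rows are imported, not re-proved.

References: M. Giaquinta, *Multiple integrals in the calculus of variations and nonlinear elliptic systems* (1983), Ch. III §2 [Giaquinta1984];
T. Bałaban, CMP 95 (1984) 17–40 [Balaban1984PropagatorsI] ((1.21) p.21); CMP 99 (1985) 75–102 [Balaban1985RegularSpaces] ((1.36) p.82).
-/

set_option autoImplicit false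

noncomputable section

open scoped BigOperators

namespace Summit.QuantumFields.YangMills.Theorems.Prop7InterpErrorHarmonicLetters

open Literature.MathematicalPhysics.QuantumFieldTheory.Balaban1983to89
open Finset
open B4Eq19LatticeOperators (Zd box mem_box box_mono self_mem_box lop dvg lop_apply dvg_apply unitVec)
open LatticeFieldCalculus (laplace supDist)
open B10Eq27TorusAxialLog (transl transl_apply transl_zero)
open B3Taylor310LocalRemainder (tdist_eq_sum_natAbs tdist_comm tdist_self)
open B3TorusRadialSums (supDist_le_tdist supDist_eq_zero_iff supDist_comm card_shell_le shell)
open B5Eq117TorusCarriers (EK)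
open Literature.Probability.LatticeModels (torusGreen TorusSite)
open Summit.QuantumFields.YangMills.Theorems.Prop7FlatInteriorMeanValue (sq_le_of_harmonic lop_pullback_eq_laplace)
open Summit.QuantumFields.YangMills.Theorems.Prop7FlatSourcedMeanValue (sq_le_of_lop_eq_dvg)
open Summit.QuantumFields.YangMills.Theorems.Prop7GreenKernelSiteTransport (laplace_eq_sq_smul_laplace_one)
open Summit.QuantumFields.YangMills.Theorems.Prop7GreenKernelSiteRows (tdist_sq_le_card_mul_sum_sq)
open Summit.QuantumFields.YangMills.Theorems.Prop7NearFieldGreenGradientSum (valMinAbs_intCast_of_two_mul_abs_lt)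
open Summit.QuantumFields.YangMills.Theorems.Prop7NearFieldGreenSizeSum (abs_torusGreen_le)
open Summit.QuantumFields.YangMills.Theorems.Prop7TorusGreenSizeDecay (abs_torusGreen_EK_sub_mul_dist_le)

variable {P : Params} {j : ℕ}

/-! ## §1 The periodic pullback on a box: distance, injectivity, box sum ≤ ball sum, the lift -/

/-- coordinates of a translate minus the base point: `(x₀ + w)_μ − (x₀)_μ = w_μ (mod N)`. [folklore] -/
theorem transl_sub_apply (x₀ : Site P j) (w : Zd P.d) (μ : Fin P.d) :
    transl x₀ w μ - x₀ μ = ((w μ : ℤ) : ZMod (P.sitesPerDir j)) := by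
  rw [transl_apply]; exact add_sub_cancel_left _ _

/-- inside the no-wrap box the least-absolute-value residue of `(x₀ + w)_μ − (x₀)_μ` IS `w_μ`. [folklore] -/
theorem valMinAbs_transl_sub (x₀ : Site P j) {r : ℕ} (hr : 2 * r < P.sitesPerDir j) {w : Zd P.d}
    (hw : w ∈ box (0 : Zd P.d) r) (μ : Fin P.d) :
    ((transl x₀ w μ - x₀ μ).valMinAbs : ℤ) = w μ := by
  rw [transl_sub_apply]
  have hwμ : |w μ| ≤ r := by have := (mem_box.1 hw) μ; simpa using this
  refine valMinAbs_intCast_of_two_mul_abs_lt ?_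
  have : (2 * r : ℤ) < (P.sitesPerDir j : ℤ) := by exact_mod_cast hr
  linarith

/-- the `ℓ¹` torus distance of a no-wrap translate: `tdist(x₀ + w, x₀) = Σ_μ |w_μ|`. [cite: Balaban1984PropagatorsI, (1.17) p.20] -/
theorem tdist_transl_eq (x₀ : Site P j) {r : ℕ} (hr : 2 * r < P.sitesPerDir j) {w : Zd P.d}
    (hw : w ∈ box (0 : Zd P.d) r) :
    (Site.tdist (transl x₀ w) x₀ : ℤ) = ∑ μ, |w μ| := by
  rw [tdist_eq_sum_natAbs, Nat.cast_sum]
  refine Finset.sum_congr rfl fun μ _ => ?_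
  rw [Int.natCast_natAbs, valMinAbs_transl_sub x₀ hr hw μ]

/-- … hence `tdist(x₀ + w, x₀) ≤ d·r` on the box. [cite: Balaban1984PropagatorsI, (1.17) p.20] -/
theorem tdist_transl_le (x₀ : Site P j) {r : ℕ} (hr : 2 * r < P.sitesPerDir j) {w : Zd P.d}
    (hw : w ∈ box (0 : Zd P.d) r) :
    (Site.tdist (transl x₀ w) x₀ : ℝ) ≤ (P.d : ℝ) * r := by
  have h := tdist_transl_eq x₀ hr hw
  have h2 : (∑ μ : Fin P.d, |w μ|) ≤ (P.d : ℤ) * r := by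
    calc (∑ μ : Fin P.d, |w μ|) ≤ ∑ _μ : Fin P.d, (r : ℤ) :=
          Finset.sum_le_sum fun μ _ => by have := (mem_box.1 hw) μ; simpa using this
      _ = (P.d : ℤ) * r := by rw [Finset.sum_const, Finset.card_univ, Fintype.card_fin]; simp
  have h3 : (Site.tdist (transl x₀ w) x₀ : ℤ) ≤ (P.d : ℤ) * r := h ▸ h2
  exact_mod_cast h3

/-- the pullback is injective on the no-wrap box. [folklore] -/
theorem transl_injOn_box (x₀ : Site P j) {r : ℕ} (hr : 2 * r < P.sitesPerDir j) :
    ∀ w ∈ box (0 : Zd P.d) r, ∀ w' ∈ box (0 : Zd P.d) r, transl x₀ w = transl x₀ w' → w = w' := by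
  intro w hw w' hw' h
  funext μ
  rw [← valMinAbs_transl_sub x₀ hr hw μ, ← valMinAbs_transl_sub x₀ hr hw' μ, show transl x₀ w μ = transl x₀ w' μ from congrFun h μ]

/-- ★ **BOX SUM ≤ BALL SUM**: for `g ≥ 0`, `2r < N` and `d·r ≤ ρ`, `Σ_{w ∈ box 0 r} g(x₀ + w) ≤ Σ_{tdist(z,x₀) ≤ ρ} g(z)` (injectivity on the box and
`tdist(x₀ + w, x₀) ≤ d·r`). [folklore] -/
theorem sum_box_pullback_le_sum_ball (x₀ : Site P j) {r : ℕ} (hr : 2 * r < P.sitesPerDir j) {ρ : ℝ} (hρ : (P.d : ℝ) * r ≤ ρ)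
    (g : Site P j → ℝ) (hg : ∀ z, 0 ≤ g z) :
    ∑ w ∈ box (0 : Zd P.d) r, g (transl x₀ w)
      ≤ ∑ z ∈ Finset.univ.filter (fun z : Site P j => (Site.tdist z x₀ : ℝ) ≤ ρ), g z := by
  classical
  rw [← Finset.sum_image (f := g) (transl_injOn_box x₀ hr)]
  refine Finset.sum_le_sum_of_subset_of_nonneg (fun z hz => ?_) fun z _ _ => hg z
  rw [Finset.mem_image] at hz
  obtain ⟨w, hw, rfl⟩ := hz
  rw [Finset.mem_filter]
  exact ⟨Finset.mem_univ _, (tdist_transl_le x₀ hr hw).trans hρ⟩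

/-- **THE LIFT**: every `x` with `tdist(x, x₀) ≤ ρ₀` is `x₀ + w` for the `valMinAbs` coordinates `w ∈ box 0 ρ₀`. [folklore] -/
theorem exists_eq_transl_of_tdist_le (x₀ x : Site P j) {ρ₀ : ℕ} (h : Site.tdist x x₀ ≤ ρ₀) :
    ∃ w ∈ box (0 : Zd P.d) ρ₀, x = transl x₀ w := by
  refine ⟨fun μ => ((x μ - x₀ μ).valMinAbs : ℤ), ?_, ?_⟩
  · rw [mem_box]
    intro μ
    rw [Pi.zero_apply, sub_zero]
    have h1 : ((x μ - x₀ μ).valMinAbs).natAbs ≤ Site.tdist x x₀ := by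
      rw [tdist_eq_sum_natAbs]
      exact Finset.single_le_sum (f := fun ν => ((x ν - x₀ ν).valMinAbs).natAbs) (fun ν _ => Nat.zero_le _) (Finset.mem_univ μ)
    rw [← Int.natCast_natAbs]
    exact_mod_cast h1.trans h
  · funext μ
    rw [transl_apply, ZMod.coe_valMinAbs]
    abel

/-- the lattice Laplacian with factor `c` is `c²` times the one with factor `1` (reading of ✓ `laplace_eq_sq_smul_laplace_one`). [folklore] -/
theorem laplace_eq_sq_mul_laplace_one (c : ℝ) (f : SiteField P j ℝ) (z : Site P j) :
    laplace c f z = c ^ 2 * laplace 1 f z := by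
  rw [laplace_eq_sq_smul_laplace_one, smul_eq_mul]

/-! ## §2 ★★ BULK core: a site function harmonic on a `tdist`-ball is controlled at the centre by its `ℓ²` mass on the ball -/

/-- ★★ **INTERIOR MEAN-VALUE BOUND ON A `tdist`-BALL OF THE TORUS.**  `c ≠ 0`, `n ≥ 1`, `r := n + d(n+2)` with `2r < N` (no wrap) and
`d·r ≤ ρ`; if `laplace c V z = 0` for every `z` with `tdist(z, x) ≤ ρ`, then
`V(x)² ≤ 2^d(1+56d)^d(n+1)^{−d} · Σ_{tdist(z,x) ≤ ρ} V(z)²`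
(✓ `Prop7FlatInteriorMeanValue.sq_le_of_harmonic` for the pullback `w ↦ V(x + w)` on `box 0 r`, harmonic there by ✓ `lop_pullback_eq_laplace`,
then `sum_box_pullback_le_sum_ball`). [cite: Giaquinta1984, Ch. III §2 (2.5) p.78] -/
theorem sq_le_mul_sum_ball_of_laplace_eq_zero {c : ℝ} (hc : c ≠ 0) (x : Site P j) (V : SiteField P j ℝ)
    {n r : ℕ} (hn : 1 ≤ n) (hr : r = n + P.d * (n + 2)) (hN : 2 * r < P.sitesPerDir j) {ρ : ℝ} (hρ : (P.d : ℝ) * r ≤ ρ)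
    (hV : ∀ z, (Site.tdist z x : ℝ) ≤ ρ → laplace c V z = 0) :
    V x ^ 2 ≤ (2 : ℝ) ^ P.d * (1 + 56 * P.d) ^ P.d / ((n : ℝ) + 1) ^ P.d *
      ∑ z ∈ Finset.univ.filter (fun z : Site P j => (Site.tdist z x : ℝ) ≤ ρ), V z ^ 2 := by
  classical
  have hrz : ((0 : ℤ) + n + P.d * ((n : ℤ) + 2)) = (r : ℤ) := by rw [hr]; push_cast; ring
  have hh : ∀ w ∈ box (0 : Zd P.d) ((0 : ℤ) + n + P.d * ((n : ℤ) + 2)), lop 0 (fun w => V (transl x w)) w = 0 := by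
    intro w hw
    rw [hrz] at hw
    rw [lop_pullback_eq_laplace]
    have h0 := hV _ ((tdist_transl_le x hN hw).trans hρ)
    rw [laplace_eq_sq_mul_laplace_one] at h0
    exact (mul_eq_zero.1 h0).resolve_left (pow_ne_zero 2 hc)
  have h := sq_le_of_harmonic (κ := 0) le_rfl hn le_rfl (fun w => V (transl x w)) hh (self_mem_box (0 : Zd P.d) le_rfl)
  rw [transl_zero, hrz] at h
  exact h.trans (mul_le_mul_of_nonneg_left (sum_box_pullback_le_sum_ball x hN hρ (fun z => V z ^ 2) fun z => sq_nonneg _)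
    (by positivity))

/-! ## §3 ★★ PIN core: a site function with CONSTANT Laplacian on a `tdist`-ball -/

/-- the linear bond field `w ↦ −(σ∕d)·w_μ` has lattice divergence `σ`. [folklore] -/
theorem dvg_linear (hd : 1 ≤ P.d) (σ : ℝ) (w : Zd P.d) :
    dvg (fun (v : Zd P.d) (μ : Fin P.d) => -(σ / P.d) * (v μ : ℝ)) w = σ := by
  have hd0 : (P.d : ℝ) ≠ 0 := by exact_mod_cast (Nat.one_le_iff_ne_zero.1 hd)
  rw [dvg_apply]
  have e : ∀ μ : Fin P.d, (-(σ / P.d) * (((w - unitVec μ) μ : ℤ) : ℝ) - -(σ / P.d) * ((w μ : ℤ) : ℝ)) = σ / P.d := by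
    intro μ
    have : (((w - unitVec μ) μ : ℤ) : ℝ) = ((w μ : ℤ) : ℝ) - 1 := by
      rw [Pi.sub_apply, unitVec, Pi.single_eq_same]; push_cast; ring
    rw [this]; ring
  rw [Finset.sum_congr rfl fun μ _ => e μ, Finset.sum_const, Finset.card_univ, Fintype.card_fin, nsmul_eq_mul]
  field_simp

/-- the same linear field is bounded by `|σ|(r+1)∕d` on `box 0 (r+1)`. [folklore] -/
theorem abs_linear_le (hd : 1 ≤ P.d) (σ : ℝ) {r : ℕ} (w : Zd P.d) (hw : w ∈ box (0 : Zd P.d) ((r : ℤ) + 1)) (μ : Fin P.d) :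
    |-(σ / P.d) * ((w μ : ℤ) : ℝ)| ≤ |σ| * ((r : ℝ) + 1) / P.d := by
  have hd0 : (0 : ℝ) < P.d := by exact_mod_cast hd
  have hwμ : |((w μ : ℤ) : ℝ)| ≤ (r : ℝ) + 1 := by
    have := (mem_box.1 hw) μ
    rw [Pi.zero_apply, sub_zero] at this
    exact_mod_cast this
  rw [abs_mul, abs_neg, abs_div, abs_of_pos hd0]
  calc |σ| / P.d * |((w μ : ℤ) : ℝ)| ≤ |σ| / P.d * ((r : ℝ) + 1) := mul_le_mul_of_nonneg_left hwμ (by positivity)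
    _ = |σ| * ((r : ℝ) + 1) / P.d := by ring

/-- ★★ **SOURCED MEAN-VALUE BOUND ON A `tdist`-BALL FOR A CONSTANT LAPLACIAN.**  `d ≥ 1`, `n ≥ 1`, `r = ρ₀ + n + d(n+2)`, `2(r+1) < N`,
`d·r ≤ ρ`; if `laplace 1 W z = σ` for every `z` with `tdist(z, y) ≤ d(r+1)`, then for every `x` with `tdist(x, y) ≤ ρ₀`:
`W(x)² ≤ 4K·Σ_{tdist(z,y) ≤ ρ} W(z)² + (4K(2r+1)^d + 2)·(64·2^d·d·m·(2r+1))²`, `K = 2^d(1+56d)^d(n+1)^{−d}`, `m = |σ|(r+1)∕d`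
(✓ `Prop7FlatSourcedMeanValue.sq_le_of_lop_eq_dvg` for the pullback with the constant written as `dvg` of the linear field, at the lift of `x`,
then `sum_box_pullback_le_sum_ball`). [cite: Giaquinta1984, Ch. III §2 Thm 2.2 p.78] -/
theorem sq_le_of_laplace_one_eq_const (hd : 1 ≤ P.d) (y : Site P j) (W : SiteField P j ℝ) (σ : ℝ)
    {n ρ₀ r : ℕ} (hn : 1 ≤ n) (hr : r = ρ₀ + n + P.d * (n + 2)) (hN : 2 * (r + 1) < P.sitesPerDir j) {ρ : ℝ} (hρ : (P.d : ℝ) * r ≤ ρ)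
    (hW : ∀ z, (Site.tdist z y : ℝ) ≤ (P.d : ℝ) * ((r : ℝ) + 1) → laplace 1 W z = σ)
    (x : Site P j) (hx : Site.tdist x y ≤ ρ₀) :
    W x ^ 2 ≤ 4 * ((2 : ℝ) ^ P.d * (1 + 56 * P.d) ^ P.d / ((n : ℝ) + 1) ^ P.d) *
        ∑ z ∈ Finset.univ.filter (fun z : Site P j => (Site.tdist z y : ℝ) ≤ ρ), W z ^ 2 +
      (4 * ((2 : ℝ) ^ P.d * (1 + 56 * P.d) ^ P.d / ((n : ℝ) + 1) ^ P.d) * (2 * (r : ℝ) + 1) ^ P.d + 2) *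
        (64 * (2 : ℝ) ^ P.d * P.d * (|σ| * ((r : ℝ) + 1) / P.d) * (2 * (r : ℝ) + 1)) ^ 2 := by
  classical
  have hN' : 2 * r < P.sitesPerDir j := by omega
  have hrz : ((ρ₀ : ℤ) + n + P.d * ((n : ℤ) + 2)) = (r : ℤ) := by rw [hr]; push_cast; ring
  have hrz1 : ((ρ₀ : ℤ) + n + P.d * ((n : ℤ) + 2) + 1) = (((r + 1 : ℕ) : ℤ)) := by rw [hr]; push_cast; ring
  -- the lift of `x`
  obtain ⟨w₀, hw₀, rfl⟩ := exists_eq_transl_of_tdist_le y x hx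
  -- the pullback solves `lop 0 u = dvg g` on `box 0 r`
  set u : Zd P.d → ℝ := fun w => W (transl y w) with hu
  set g : Zd P.d → Fin P.d → ℝ := fun v μ => -(σ / P.d) * (v μ : ℝ) with hg
  have hEq : ∀ w ∈ box (0 : Zd P.d) ((ρ₀ : ℤ) + n + P.d * ((n : ℤ) + 2)), lop 0 u w = dvg g w := by
    intro w hw
    rw [hrz] at hw
    rw [hu, lop_pullback_eq_laplace, hg, dvg_linear hd]
    refine hW _ ((tdist_transl_le y hN' hw).trans ?_)
    exact mul_le_mul_of_nonneg_left (by linarith) (Nat.cast_nonneg _)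
  have hgb : ∀ w ∈ box (0 : Zd P.d) ((ρ₀ : ℤ) + n + P.d * ((n : ℤ) + 2) + 1), ∀ μ, |g w μ| ≤ |σ| * ((r : ℝ) + 1) / P.d := by
    intro w hw μ
    rw [hrz1] at hw
    have hw' : w ∈ box (0 : Zd P.d) ((r : ℤ) + 1) := by exact_mod_cast hw
    exact abs_linear_le hd σ w hw' μ
  have hm : 0 ≤ |σ| * ((r : ℝ) + 1) / P.d := by positivity
  have h := sq_le_of_lop_eq_dvg hd hn (by positivity : (0 : ℤ) ≤ ρ₀) u g hm hEq hgb hw₀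
  rw [hrz] at h
  have hcast : (((r : ℤ) : ℝ)) = (r : ℝ) := by norm_cast
  rw [hcast] at h
  refine h.trans (add_le_add (mul_le_mul_of_nonneg_left ?_ (by positivity)) le_rfl)
  exact sum_box_pullback_le_sum_ball y hN' hρ (fun z => W z ^ 2) fun z => sq_nonneg _

/-! ## §4 ★ The Green-function sum of the pin term (`d = 3`) -/

/-- `|G̃| ≤ C₀` everywhere, in the dimension-parameter form (✓ `abs_torusGreen_le` read through `d = 3`). [cite: LawlerLimic2010, Thm 4.3.1] -/
theorem abs_torusGreen_le_of_eq : ∃ C₀ : ℝ, 0 ≤ C₀ ∧ ∀ {d : ℕ} (_ : d = 3) (L : ℕ) [NeZero L] (z : TorusSite d L), |torusGreen z| ≤ C₀ := by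
  obtain ⟨C₀, hC₀, h⟩ := abs_torusGreen_le
  refine ⟨C₀, hC₀, ?_⟩
  intro d hd
  subst hd
  exact h

/-- the pointwise Green row in `tdist` letters: `|G̃(EK y − EK z)|·tdist(y,z) ≤ √d·C_S` for `z ≠ y` (`P.d = 3`; ✓ `abs_torusGreen_EK_sub_mul_dist_le` +
✓ `tdist_sq_le_card_mul_sum_sq`). [cite: Balaban1985RegularSpaces, (1.36) p.82] -/
theorem abs_torusGreen_EK_sub_mul_tdist_le : ∃ C : ℝ, 0 ≤ C ∧ ∀ (P : Params) (_ : P.d = 3) (k : ℕ) (hk : k ≤ P.m + P.K)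
    (y z : Site P 0), z ≠ y →
      |torusGreen (L := P.L ^ k * P.sitesPerDir k) (EK hk y - EK hk z)| * (Site.tdist y z : ℝ) ≤ C := by
  obtain ⟨C, hC⟩ := abs_torusGreen_EK_sub_mul_dist_le
  refine ⟨Real.sqrt 3 * max C 0, by positivity, ?_⟩
  intro P hd k hk y z hzy
  have h1 := hC P hd k hk z y (Ne.symm hzy)
  have h2 := tdist_sq_le_card_mul_sum_sq hk y z
  have hd3 : (P.d : ℝ) = 3 := by exact_mod_cast hd
  rw [hd3] at h2
  set S : ℝ := ∑ μ, ((((EK hk y - EK hk z) μ).valMinAbs : ℤ) : ℝ) ^ 2 with hS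
  have hS0 : 0 ≤ S := Finset.sum_nonneg fun _ _ => sq_nonneg _
  have ht : (Site.tdist y z : ℝ) ≤ Real.sqrt 3 * Real.sqrt S := by
    rw [← Real.sqrt_mul (by norm_num), ← Real.sqrt_sq (Nat.cast_nonneg (Site.tdist y z))]
    exact Real.sqrt_le_sqrt h2
  have hG0 : 0 ≤ |torusGreen (L := P.L ^ k * P.sitesPerDir k) (EK hk y - EK hk z)| := abs_nonneg _
  calc |torusGreen (L := P.L ^ k * P.sitesPerDir k) (EK hk y - EK hk z)| * (Site.tdist y z : ℝ)
      ≤ |torusGreen (L := P.L ^ k * P.sitesPerDir k) (EK hk y - EK hk z)| * (Real.sqrt 3 * Real.sqrt S) :=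
        mul_le_mul_of_nonneg_left ht hG0
    _ = Real.sqrt 3 * (|torusGreen (L := P.L ^ k * P.sitesPerDir k) (EK hk y - EK hk z)| * Real.sqrt S) := by ring
    _ ≤ Real.sqrt 3 * max C 0 := mul_le_mul_of_nonneg_left (h1.trans (le_max_left _ _)) (Real.sqrt_nonneg _)

/-- ★ **THE GREEN SUM OF THE PIN TERM**: in `d = 3` there is `C ≥ 0` with `Σ_{tdist(z,y) ≤ ρ} G̃(EK y − EK z)² ≤ C·(ρ + 1)` for every base `y` and
radius `ρ : ℕ` (pole: `C₀²`; `supDist`-shell `s ≥ 1`: at most `2d(2s+1)² ≤ 54s²` sites, each `≤ 3C_S²∕s²`, so `≤ 162C_S²` per shell). [cite: LawlerLimic2010, Thm 4.3.1] -/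
theorem sum_ball_sq_torusGreen_EK_le : ∃ C : ℝ, 0 ≤ C ∧ ∀ (P : Params) (_ : P.d = 3) (k : ℕ) (hk : k ≤ P.m + P.K)
    (y : Site P 0) (ρ : ℕ),
      ∑ z ∈ Finset.univ.filter (fun z : Site P 0 => (Site.tdist z y : ℝ) ≤ ρ),
        (torusGreen (L := P.L ^ k * P.sitesPerDir k) (EK hk y - EK hk z)) ^ 2 ≤ C * ((ρ : ℝ) + 1) := by
  classical
  obtain ⟨C₀, hC₀, hG0⟩ := abs_torusGreen_le_of_eq
  obtain ⟨C₁, hC₁, hG1⟩ := abs_torusGreen_EK_sub_mul_tdist_le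
  refine ⟨max (C₀ ^ 2) (162 * C₁ ^ 2), by positivity, ?_⟩
  intro P hd k hk y ρ
  haveI : NeZero (P.L ^ k * P.sitesPerDir k) := ⟨mul_ne_zero (pow_ne_zero _ P.L_pos.ne') (P.sitesPerDir_ne_zero k)⟩
  set M : ℝ := max (C₀ ^ 2) (162 * C₁ ^ 2) with hM
  have hM0 : 0 ≤ M := by positivity
  set g : Site P 0 → ℝ := fun z => (torusGreen (L := P.L ^ k * P.sitesPerDir k) (EK hk y - EK hk z)) ^ 2 with hgdef
  -- the ball is covered by the `supDist`-shells `s = 0, …, ρ`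
  have hsub : Finset.univ.filter (fun z : Site P 0 => (Site.tdist z y : ℝ) ≤ ρ)
      ⊆ (Finset.range (ρ + 1)).biUnion fun s => shell y s := by
    intro z hz
    rw [Finset.mem_filter] at hz
    rw [Finset.mem_biUnion]
    refine ⟨supDist y z, Finset.mem_range.2 (Nat.lt_succ_of_le ?_), by simp [shell]⟩
    have h1 : supDist y z ≤ Site.tdist y z := supDist_le_tdist y z
    rw [tdist_comm] at h1
    exact_mod_cast (show (supDist y z : ℝ) ≤ ρ from le_trans (by exact_mod_cast h1) hz.2)
  -- the shells are pairwise disjoint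
  have hdisj : Set.PairwiseDisjoint (↑(Finset.range (ρ + 1)) : Set ℕ) (fun s => shell y s) := by
    intro s _ s' _ hne
    rw [Function.onFun, Finset.disjoint_left]
    intro z hz hz'
    have h1 : supDist y z = s := by simpa [shell] using hz
    have h2 : supDist y z = s' := by simpa [shell] using hz'
    exact hne (h1.symm.trans h2)
  -- one shell
  have hshell : ∀ s ∈ Finset.range (ρ + 1), ∑ z ∈ shell y s, g z ≤ M := by
    intro s _
    rcases Nat.eq_zero_or_pos s with h0 | hs
    · -- the pole
      subst h0
      have hsh : shell y 0 = {y} := by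
        ext z
        simp only [shell, Finset.mem_filter, Finset.mem_univ, true_and, Finset.mem_singleton, supDist_eq_zero_iff]
        exact eq_comm
      rw [hsh, Finset.sum_singleton, hgdef]
      dsimp only
      rw [sub_self]
      have := hG0 hd (P.L ^ k * P.sitesPerDir k) (0 : TorusSite P.d (P.L ^ k * P.sitesPerDir k))
      calc (torusGreen (0 : TorusSite P.d (P.L ^ k * P.sitesPerDir k))) ^ 2 ≤ C₀ ^ 2 := by
            rw [← sq_abs]; exact pow_le_pow_left₀ (abs_nonneg _) this 2
        _ ≤ M := le_max_left _ _
    · -- a shell `s ≥ 1`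
      have hpt : ∀ z ∈ shell y s, g z ≤ 3 * C₁ ^ 2 / (s : ℝ) ^ 2 := by
        intro z hz
        have hzs : supDist y z = s := by simpa [shell] using hz
        have hzy : z ≠ y := by
          intro h; rw [h, (supDist_eq_zero_iff y y).2 rfl] at hzs; omega
        have hts : (s : ℝ) ≤ Site.tdist y z := by
          have := supDist_le_tdist y z; rw [hzs] at this; exact_mod_cast this
        have hs0 : (0 : ℝ) < s := by exact_mod_cast hs
        have h1 := hG1 P hd k hk y z hzy
        -- `|G| ≤ C₁ / tdist ≤ C₁ / s`
        have hGle : |torusGreen (L := P.L ^ k * P.sitesPerDir k) (EK hk y - EK hk z)| ≤ C₁ / s := by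
          rw [le_div_iff₀ hs0]
          exact (mul_le_mul_of_nonneg_left hts (abs_nonneg _)).trans h1
        rw [hgdef]; dsimp only
        rw [← sq_abs]
        calc |torusGreen (L := P.L ^ k * P.sitesPerDir k) (EK hk y - EK hk z)| ^ 2 ≤ (C₁ / s) ^ 2 :=
              pow_le_pow_left₀ (abs_nonneg _) hGle 2
          _ = C₁ ^ 2 / (s : ℝ) ^ 2 := by rw [div_pow]
          _ ≤ 3 * C₁ ^ 2 / (s : ℝ) ^ 2 := by
              refine div_le_div_of_nonneg_right ?_ (by positivity); nlinarith [sq_nonneg C₁]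
      have hcard := card_shell_le y hs
      rw [hd] at hcard
      norm_num at hcard
      have hs1 : (1 : ℝ) ≤ s := by exact_mod_cast hs
      calc ∑ z ∈ shell y s, g z ≤ ∑ _z ∈ shell y s, 3 * C₁ ^ 2 / (s : ℝ) ^ 2 := Finset.sum_le_sum hpt
        _ = (shell y s).card * (3 * C₁ ^ 2 / (s : ℝ) ^ 2) := by rw [Finset.sum_const, nsmul_eq_mul]
        _ ≤ (6 * (2 * (s : ℝ) + 1) ^ 2) * (3 * C₁ ^ 2 / (s : ℝ) ^ 2) := mul_le_mul_of_nonneg_right hcard (by positivity)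
        _ ≤ (6 * (9 * (s : ℝ) ^ 2)) * (3 * C₁ ^ 2 / (s : ℝ) ^ 2) := by
            refine mul_le_mul_of_nonneg_right (mul_le_mul_of_nonneg_left ?_ (by norm_num)) (by positivity)
            nlinarith
        _ = 162 * C₁ ^ 2 := by field_simp; ring
        _ ≤ M := le_max_right _ _
  calc ∑ z ∈ Finset.univ.filter (fun z : Site P 0 => (Site.tdist z y : ℝ) ≤ ρ), g z
      ≤ ∑ z ∈ (Finset.range (ρ + 1)).biUnion (fun s => shell y s), g z :=
        Finset.sum_le_sum_of_subset_of_nonneg hsub fun z _ _ => by rw [hgdef]; exact sq_nonneg _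
    _ = ∑ s ∈ Finset.range (ρ + 1), ∑ z ∈ shell y s, g z := Finset.sum_biUnion hdisj
    _ ≤ ∑ _s ∈ Finset.range (ρ + 1), M := Finset.sum_le_sum hshell
    _ = M * ((ρ : ℝ) + 1) := by rw [Finset.sum_const, Finset.card_range, nsmul_eq_mul]; push_cast; ring

end Summit.QuantumFields.YangMills.Theorems.Prop7InterpErrorHarmonicLetters

end
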